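import Mathlib

/-!
# `Balaban1983to89.B14Radii` — [Balaban1988Convergent] p. 261, (2.34)–(2.39): the RADII of the multi-scale
analyticity spaces `Ũᶜ_j(X, α̃₀, α̃₁)` typed VERBATIM, with the real-number bookkeeping behind the p. 277 sentence
*"This is the reason for putting the powers of 1/2 in the conditions (2.36)–(2.39)"* KERNEL-CHECKED as far as it is
arithmetic (cell `GAPS.md` G-B14s-15, `SMALLNESS.md` S-B14.23, S-B14.8, §4.1 (X12))

CITATION HEADER (lean-in-tree rule 2026-08-18).  Source: T. Bałaban, *Convergent renormalization expansions for
lattice gauge theories*, Commun. Math. Phys. **119**, 243–285 (1988) [Balaban1988Convergent] (cell paper B14 =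
[III]; held `paper:balaban1988-cmp119-convergent-renormalization`, journal page = PDF page + 242), with
[Balaban1987RG1] (= [I], cell paper B12, CMP **109**) p. 263 and [Balaban1989LargeFieldI] (= [IV], cell paper B15,
CMP **122**) for the sibling uses of the same factor family.  Quotations below were read on the x2 page renders
p013, p017, p018, p019, p020, p024, p034, p035 of the cell folder `b2b-balaban-ref1/pages/1988-cmp119-convergent-
renormalization/` and `…/1987-cmp109-rg-I-small-field/…-p015-x2.png`.  The paper is a manuscript UNDER ADJUDICATION
by the audit cell `pub-balaban`: NOTHING printed in it is asserted here.  Every `theorem` is elementary real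
arithmetic (or the triangle inequality in a seminormed group), proved without `sorry` and without new axioms.  NEW
sibling module of unit `b2b-balaban-pv02` (gen 3, journal claim G-B14s-15-KERNEL; B14 §§1–3 are pv02's typing remit);
it imports Mathlib only and modifies nothing (the abstract field `Step.LFTower.spaceB` of `…Balaban1983to89.Step`
leaves these radii unspecified, cell `DIVERGENCE.md` D-f2.7; they were not typed anywhere in the tree before).

THE PRINTED TEXT (verbatim).
* p. 255 [PDF 13]: *"Now let us define numbers describing sizes of domains and restrictions on fields. We define
  ε_j = g_jA₀(log g_j^{−2})^{p₀} = g_jp₀(g_j); (2.4)"*.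
* p. 259 [17]: *"α_{0,j} = g_jC₀(log g_j^{−2})^{q₀}, α_{1,j} = g_jC₁(log g_j^{−2})^{q₁}, (2.28) where q₀, q₁ are
  integers greater than 1, C₀, C₁ are sufficiently large positive numbers."*
* p. 260 [18] – p. 261 [19]: *"The terms of 𝐁_k are analytic functions of the variables (𝐔, 𝐉) introduced in the
  same way as in the regular cases before. The analyticity domains are spaces defined similarly as in
  (I.1.11)–(I.1.16), but now we must take into account the existence of many different scales. We introduce the
  following definition.  The space Ũᶜ_j(X, α̃₀, α̃₁) for X ∈ 𝐃_j is the set of configurations (𝐔, 𝐉) defined on X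
  and satisfying the three conditions below.  (i) 𝐔 = U′U, U has values in the group G, and the configurations
  U, 𝐔, U_{p,X}(M˙(𝐔)) = U(𝐁_p(X)∪{Γ_i}_{i<p}, M˙(𝐔)), 𝐉, J_{p,X}(M˙(𝐔)) satisfy the bounds
  |∂U − 1|, |∂𝐔 − 1| < (1 − β(1 − 2^{−(j−n)}))α_{0,n}ξ²(Lⁿξ)^{−2}, (2.34)
  |∂U_{p,X}(M˙(𝐔)) − 1| < (1 − β(1 − 2^{−(j−n)}))α_{0,n}L^{−2p}(LⁿL^{−p})^{−2}, (2.35)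
  |𝐉| < (1 − β(1 − 2^{−(j−n)}))α_{0,n}(Lⁿξ)^{−3}, (2.36)
  |𝐉_{p,X}(M˙(𝐔))| < (1 − β(1 − 2^{−(j−n)}))α_{0,n}L^{n−min{p,n}}(LⁿL^{−p})^{−3}, (2.37)
  on X∩(Ω_n∖Ω_{n+1}) for n = 1, …, j−1, or on X∩Ω_j for n = j.  (ii) For each cube □ ⊂ Ω_n∖Ω_{n+2},
  □∩Ωᶜ_{n+1} ≠ ∅, n = 1, …, j−1, of the size CMLⁿξ, or □ ⊂ Ω_j and of the size CM, there exists a gauge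
  transformation u defined on □∩X and such, that U^u = exp iξA, Lⁿξ|A|, (Lⁿξ)²|∇^ξA| < BCMα_{0,n} (2.38) on □∩X,
  with an absolute constant B.  (iii) U′ = exp iξA′, A′ has values in the algebra 𝐠ᶜ,
  Lⁿξ|A′|, (Lⁿξ)²|∇^ξ_U A′| < (1 − β(1 − 2^{−(j−n)}))α_{1,n} (2.39) on X∩(Ω_n∖Ω_{n+1}) for n = 1, …, j−1, or on
  X∩Ω_j for n = j.  The number β is a small positive constant, but not too small, e.g., we can take β = 1/4."*
* p. 262 [20]: *"More precisely, the expressions with indices j < k are exactly as described above, but the newly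
  created expressions E^{(k)}, 𝐑^{(k)}, 𝐁^{(k)} are defined on slightly larger spaces, with the coefficients in their
  definition bigger by β multiplied by a corresponding number, and they have better decay properties, with the
  number κ replaced, for example, by (1 + 4β)κ. Such improved bounds are needed for the 𝐑-operation."*
* p. 276 [34]: *"The remaining terms satisfy such conditions also, but with analyticity space (I.6.34) replaced by
  the space Ũᶜ_{k+1}(Y, (1+β)α̃₀, (1+β)α̃₁) × {A : supp A ⊂ Y∩Λ^{(k)*}_{k+1}, |A| < C₁p₁(g_k)} (3.43)"*.
* pp. 276–277 [34–35] (p. 276 ends with the first sentence and «Notice that on the»): *"Terms of this expansion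
  can be extended [as in (I.3.13)] to analytic functions defined on the corresponding spaces (3.43). Notice that on the
  domain Ωᶜ_{k+1} there is no regularity improvement of the configuration U_{k+1}; on the
  other hand we have to use a part of the analyticity domains of terms in 𝐁_k for the function H_k. This is the
  reason for putting the powers of 1/2 in the conditions (2.36)–(2.39). The analyticity domains become smaller
  after each step, but the difference is very small and exponentially decreasing in the number of steps. The
  localization of the fluctuation field, and the exponential decay of the minimizing function H_k imply that this
  difference is still much greater than bounds on this function. The terms of the expansion can be estimated as in
  (2.42), but with the additional factor O(ε_k) arising from the bound of the fluctuation field."*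
* [I] = [Balaban1987RG1] p. 263 [PDF 15] (the single-scale original): *"We assume that the constants α₀′, α₁′ are
  smaller than α₀, α₁ correspondingly"*; (1.17) *"|∂U_n(M˙(𝐔)) − 1| < B₃2α₀′L^{−2n}(Lⁿξ)² = 2B₃α₀′ξ²"*; *"It is
  obvious that for α₀′ sufficiently small the above estimates imply the condition (iv)"*; *"In particular the
  minimal configurations U_j satisfying the bound |∂U_j − 1| < ε₀ξ² with ε₀ sufficiently small, satisfy the above
  conditions."*; and *"the action A_k(U) defined on the space U_k(ε₀), which is contained in all the spaces
  Uᶜ_j(X, α₀, α₁)"* (unbolded `U` as printed; cell `SMALLNESS.md` S-B12.5: «2B₃α₀′ ≤ α₀»).  [v1.1 DOCFIX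
  2026-08-18 (referee XREAD `b2b-balaban-pv23`, GAPS C-pv23-7 R1/R2): the bracket *"[as in (I.3.13)]"* — printed,
  p. 276 last lines, re-read on render p034 — restored in the bullet above and its page label corrected to
  pp. 276–277; the three `U`'s of this [I] p. 263 fragment unbolded as printed (render p015 re-read); no
  declaration changed.]

WHAT IS TYPED (§A).  The factor `shrink β m = 1 − β(1 − 2^{−m})`, `m = j − n`, and the six printed radii as
real-valued functions of the printed letters: `rad234`, `rad235`, `rad236`, `rad237`, `rad238` (NO factor — as
printed, (2.38) carries `BCMα_{0,n}` only), `rad239`; the normal forms `rad234_eq` (the radius of (2.34) equals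
`shrink·α_{0,n}·L^{−2n}`, the letter ξ cancels) and `rad236_eq_div`.

WHAT IS KERNEL-CHECKED (§§B–E; each item elementary).
(B) The factor family: `shrink β 0 = 1` (innermost region, n = j), `shrink β 1 = 1 − β/2`, antitone in `m` for
  `β ≥ 0` with consecutive differences `shrink β m − shrink β (m+1) = β·2^{−(m+1)}` (*"exponentially decreasing"*),
  floor `1 − β ≤ shrink β m` (strict for `β > 0`) — so the radii never degenerate, uniformly in the number of scales —
  `3/4 < shrink β m` for `β ≤ 1/4` (the printed choice; the same inequality is `…B15.BasicStep.coeff196` for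
  [IV] (1.96)), the telescoping sum `Σ_{i<m} (shrink β i − shrink β (i+1)) = β(1 − 2^{−m})` and the total
  `HasSum (fun m ↦ shrink β m − shrink β (m+1)) β`: claim (a) of G-B14s-15 — the losses over all steps sum to exactly
  `β` times the scale-n coefficient, inside the initial radius.
(C) Absorption: in any seminormed additive group, `‖u′ − c‖ < r′`, `‖u − u′‖ ≤ s`, `r′ + s ≤ r ⟹ ‖u − c‖ < r`
  (`absorb`), and its one-index-step instance with radii `A·shrink β (m+1)·ρ ⊂ A·shrink β m·ρ` and room
  `A·β·2^{−(m+1)}·ρ` (`absorb_step`) — the exact shape of claim (b) *"we have to use a part of the analyticity domains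
  … for the function H_k"*: a shift of the argument by at most the one-step room keeps it inside the larger space.
(D) The one-step room at layer `n` when the space index advances `k → k+1`, in the common units of `rad234_eq`
  (`room`, `room_eq`, `room_innermost`: at the innermost layer `n = k` it is `A·(β/2)·α_{0,k}·L^{−2k}`), the
  comparison with a shift of plaquette size `c·ε_k·L^{−2k}` (`innermost_fits_iff`: ⟺ `c·ε_k ≤ A(β/2)α_{0,k}`), and
  `room_mono_layer`: for `β ≥ 0`, `L > 0` the room at an OLDER layer `n ≤ k` is at least the innermost one as soon as
  `α_{0,k} ≤ (L²/2)^{k−n}α_{0,n}` — the factor `L^{2(k−n)}` of the coarser plaquette scale beats the `2^{−(k−n)}` of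
  the half-powers, so the innermost layer is the binding comparison even before the exponential decay of `H_k` that
  p. 277 invokes for the older layers is used.
(E) The exponent bookkeeping of the binding comparison `c·ε_j ≤ κ·α_{0,j}` with the printed (2.4), (2.28)
  (`x = log g_j^{−2} ≥ 1`, `ε_j = g_jA₀x^{p₀}`, `α_{0,j} = g_jC₀x^{q₀}`, `c, κ` absolute): SUFFICIENT `p₀ ≤ q₀` and
  `cA₀ ≤ κC₀` (`fits_of_exponents`, all `x ≥ 1`, all `g ≥ 0`); NECESSARY `p₀ ≤ q₀` as soon as the comparison is
  required for arbitrarily small couplings (`exponent_necessary`: if for every `x ≥ X` some `g > 0` satisfies it,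
  then `p₀ ≤ q₀`).  The same comparison with `κ = shrink β m ≥ 1 − β` is the multi-scale form of [I] p. 263's
  containment of the small-field configurations in the analyticity spaces (`fits_all_layers`, `fits_innermost_iff`).
  CONSEQUENCE recorded in the cell (not in the paper): `SMALLNESS.md` §4.1 (X12) «q₀ ≥ p₀ (and C₀ ≥ c·A₀/κ if
  q₀ = p₀)» — reconstructed, NOT printed ((2.28) prints only «q₀, q₁ integers greater than 1, C₀, C₁ sufficiently
  large»); it is compatible with (X1)–(X11) (q₀ occurs only in (X8)) but the §4.3 minimal witness `q₀ = 2 < p₀ = 23`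
  violates it and is re-chosen there (`example` at the end of §E).

READING (cell `DIVERGENCE.md` D-pv02.15 — recorded, not adjudicated).  (R1, used for the names in §D) p. 277 ties
the half-powers to the renormalization steps: a boundary term re-created at step k+1 from terms of 𝐁_k (p. 276:
*"To its terms we apply the formulas (3.6), (3.7) [I], and next we localize the obtained expressions … Terms of this
expansion can be extended to analytic functions defined on the corresponding spaces (3.43)"*) lives on a
`Ũᶜ_{k+1}`-space whose layer-n coefficient is `shrink β (k+1−n)` where the 𝐁_k-term had `shrink β (k−n)`; the room
`β2^{−(k+1−n)}α_{0,n}` (times the overall coefficient, `1` in (2.34) or `1+β` in (3.43) — the parameter `A` of §D)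
must absorb the shift of the argument `U_k = (exp iηH_k · U_{k+1})^{u^{−1}}` ((3.6) p. 266), whose plaquette size on
the cubes of `Ω̃_{k+1}` is the middle member of (3.8) p. 266, `(2/10)ε_kη²(1 + (4/10)ε_k)` plus
`(2/10)ε_kη·|U_{k+1}(∂p) − 1|` (typed in `…B14Sect3.Ineq38Printed`), i.e. `c·ε_kη²` with an absolute `c`.  (R2) The
same factor family organises, in [IV] pp. 186–187, 199, an induction over LAYERS at a fixed step ((1.49)/(1.50),
(1.96): `…B15.BasicStep.sf149_step`, `coeff196`); p. 261 calls (2.34)–(2.39) *"a more detailed and precise form,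
suitable for our inductive constructions, of the regularity conditions for background fields, introduced in
[13–15]"*.  The kernel content of this module (§§B, C, E) does not depend on the reading; only the names `room`,
`innermost` of §D presuppose (R1).  p. 277 names "(2.36)–(2.39)" while the factor is printed in (2.34)–(2.37) and
(2.39) and is ABSENT from (2.38) (D-pv02.15 (ii)).

WHAT IS *NOT* ASSERTED OR REPRODUCED: any bound on `H_k` or on the shift it induces on complex configurations
(the shift size `s` / the constant `c` are hypotheses; (3.7)–(3.8) are the printed real small-field instance, typed
in `…B14Sect3`); the exponential decay of `H_k` across the layers (p. 277's reason why the older layers are harmless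
— §D shows they are harmless already for scale reasons under the mild comparability hypothesis on `α_{0,·}`, which
(2.6)–(2.7) p. 255 make polynomial in `k − n`; that hypothesis is NOT discharged here); the analyticity statements
themselves; the value of `c` or `κ`; anything about `α_{1,j}`, `q₁` ((2.39) is typed, not analysed).  No statement
of the series is asserted; value = typed radii + kernel bookkeeping of a located gap + one reconstructed exponent
restriction, NOT summit progress.  Companion rows: cell `GAPS.md` G-B14s-15 (amended) and C-B14s-10 (this module),
`SMALLNESS.md` S-B14.8, S-B14.23, S-B14.30, §4.1 (X12), §4.3; `DIVERGENCE.md` D-pv02.15.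
-/

noncomputable section

namespace Literature.MathematicalPhysics.QuantumFieldTheory.Balaban1983to89.B14Radii

open Finset

/-! ## A. The factor family and the printed radii (2.34)–(2.39), p. 261 -/

/-- The factor `1 − β(1 − 2^{−m})` of (2.34)–(2.37), (2.39), p. 261, with `m = j − n` (space index minus layer
index): *"(1 − β(1 − 2^{−(j−n)}))α_{0,n} …"*; `β` is *"a small positive constant, but not too small, e.g., we can
take β = 1/4"*. [cite: Balaban1988Convergent, (2.34) p.261] -/
def shrink (β : ℝ) (m : ℕ) : ℝ := 1 - β * (1 - (1 / 2 : ℝ) ^ m)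

/-- (2.34), verbatim right-hand side: *"|∂U − 1|, |∂𝐔 − 1| < (1 − β(1 − 2^{−(j−n)}))α_{0,n}ξ²(Lⁿξ)^{−2}"* on
`X∩(Ω_n∖Ω_{n+1})` (`n < j`) or `X∩Ω_j` (`n = j`); `α₀n = α_{0,n}`, `ξ` the lattice spacing letter of p. 261.
[cite: Balaban1988Convergent, (2.34) p.261] -/
def rad234 (β α₀n ξ L : ℝ) (j n : ℕ) : ℝ := shrink β (j - n) * α₀n * ξ ^ 2 * (L ^ n * ξ) ^ (-2 : ℤ)

/-- (2.35), verbatim right-hand side: *"|∂U_{p,X}(M˙(𝐔)) − 1| < (1 − β(1 − 2^{−(j−n)}))α_{0,n}L^{−2p}(LⁿL^{−p})^{−2}"*.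
Typed for reference; not analysed here. [cite: Balaban1988Convergent, (2.35) p.261] -/
def rad235 (β α₀n L : ℝ) (j n p : ℕ) : ℝ :=
  shrink β (j - n) * α₀n * L ^ (-(2 * (p : ℤ))) * (L ^ n * L ^ (-(p : ℤ))) ^ (-2 : ℤ)

/-- (2.36), verbatim right-hand side: *"|𝐉| < (1 − β(1 − 2^{−(j−n)}))α_{0,n}(Lⁿξ)^{−3}"*.
[cite: Balaban1988Convergent, (2.36) p.261] -/
def rad236 (β α₀n ξ L : ℝ) (j n : ℕ) : ℝ := shrink β (j - n) * α₀n * (L ^ n * ξ) ^ (-3 : ℤ)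

/-- (2.37), verbatim right-hand side: *"|𝐉_{p,X}(M˙(𝐔))| < (1 − β(1 − 2^{−(j−n)}))α_{0,n}L^{n−min{p,n}}(LⁿL^{−p})^{−3}"*.
Typed for reference; not analysed here. [cite: Balaban1988Convergent, (2.37) p.261] -/
def rad237 (β α₀n L : ℝ) (j n p : ℕ) : ℝ :=
  shrink β (j - n) * α₀n * L ^ ((n : ℤ) - ((min p n : ℕ) : ℤ)) * (L ^ n * L ^ (-(p : ℤ))) ^ (-3 : ℤ)

/-- (2.38), verbatim right-hand side: *"U^u = exp iξA, Lⁿξ|A|, (Lⁿξ)²|∇^ξA| < BCMα_{0,n} (2.38) on □∩X, with an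
absolute constant B"* — NO factor `(1 − β(1 − 2^{−(j−n)}))` is printed in (2.38), although p. 277 speaks of *"the
powers of 1/2 in the conditions (2.36)–(2.39)"* (cell DIVERGENCE.md D-pv02.15 (ii)). [cite: Balaban1988Convergent, (2.38) p.261] -/
def rad238 (B C M α₀n : ℝ) : ℝ := B * C * M * α₀n

/-- (2.39), verbatim right-hand side: *"Lⁿξ|A′|, (Lⁿξ)²|∇^ξ_U A′| < (1 − β(1 − 2^{−(j−n)}))α_{1,n}"*; `α₁n = α_{1,n}`.
Typed for reference; `α_{1,n}`, `q₁` are not analysed here. [cite: Balaban1988Convergent, (2.39) p.261] -/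
def rad239 (β α₁n : ℝ) (j n : ℕ) : ℝ := shrink β (j - n) * α₁n

/-- (2.34) in normal form: the letter `ξ` cancels, `ξ²(Lⁿξ)^{−2} = L^{−2n}` — the radius is `α_{0,n}` times the
squared spacing of the n-th lattice (in units of the unit lattice), times the factor.
[cite: Balaban1988Convergent, (2.34) p.261] -/
theorem rad234_eq {β α₀n ξ L : ℝ} (hξ : ξ ≠ 0) (hL : L ≠ 0) (j n : ℕ) :
    rad234 β α₀n ξ L j n = shrink β (j - n) * α₀n / (L ^ n) ^ 2 := by
  have hLn : L ^ n ≠ 0 := pow_ne_zero _ hL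
  simp only [rad234, zpow_neg, zpow_ofNat]
  field_simp

/-- (2.36) in quotient form: `(Lⁿξ)^{−3} = 1/(Lⁿξ)³`. [cite: Balaban1988Convergent, (2.36) p.261] -/
theorem rad236_eq_div (β α₀n ξ L : ℝ) (j n : ℕ) :
    rad236 β α₀n ξ L j n = shrink β (j - n) * α₀n / (L ^ n * ξ) ^ 3 := by
  simp only [rad236, zpow_neg, zpow_ofNat, div_eq_mul_inv]

/-! ## B. The factor family `1 − β(1 − 2^{−m})`: the arithmetic of "the powers of 1/2" (p. 277) -/

/-- Innermost region (`n = j`): the factor is `1`. [cite: Balaban1988Convergent, (2.34) p.261] -/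
@[simp] theorem shrink_zero (β : ℝ) : shrink β 0 = 1 := by simp [shrink]

/-- One index step (`j − n = 1`): the factor is `1 − β/2`. [cite: Balaban1988Convergent, (2.34) p.261] -/
theorem shrink_one (β : ℝ) : shrink β 1 = 1 - β / 2 := by unfold shrink; ring

/-- `1 − shrink β m = β(1 − 2^{−m})` — the accumulated loss after `m` index steps. [cite: Balaban1988Convergent, p.277] -/
theorem one_sub_shrink (β : ℝ) (m : ℕ) : 1 - shrink β m = β * (1 - (1 / 2 : ℝ) ^ m) := by unfold shrink; ring

/-- Consecutive difference: `shrink β m − shrink β (m+1) = β·2^{−(m+1)}` — p. 277, verbatim: *"the difference is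
very small and exponentially decreasing in the number of steps"*. [cite: Balaban1988Convergent, p.277] -/
theorem shrink_sub_succ (β : ℝ) (m : ℕ) : shrink β m - shrink β (m + 1) = β * (1 / 2 : ℝ) ^ (m + 1) := by
  unfold shrink; ring

/-- The factor never exceeds `1` (`β ≥ 0`). [cite: Balaban1988Convergent, (2.34) p.261] -/
theorem shrink_le_one {β : ℝ} (hβ : 0 ≤ β) (m : ℕ) : shrink β m ≤ 1 := by
  unfold shrink
  have h1 : (1 / 2 : ℝ) ^ m ≤ 1 := pow_le_one₀ (by norm_num) (by norm_num)
  nlinarith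

/-- Uniform floor: `1 − β ≤ shrink β m` for `β ≥ 0` — the radii never degenerate, uniformly in the number of scales
(claim (a) of cell GAPS.md G-B14s-15). [cite: Balaban1988Convergent, p.277] -/
theorem one_sub_le_shrink {β : ℝ} (hβ : 0 ≤ β) (m : ℕ) : 1 - β ≤ shrink β m := by
  unfold shrink
  have h0 : 0 ≤ (1 / 2 : ℝ) ^ m := by positivity
  nlinarith

/-- Strict floor: `1 − β < shrink β m` for `β > 0`. [cite: Balaban1988Convergent, p.277] -/
theorem one_sub_lt_shrink {β : ℝ} (hβ : 0 < β) (m : ℕ) : 1 - β < shrink β m := by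
  unfold shrink
  have h0 : 0 < (1 / 2 : ℝ) ^ m := by positivity
  nlinarith

/-- The accumulated loss stays below `β`: `1 − shrink β m < β` (`β > 0`). [cite: Balaban1988Convergent, p.277] -/
theorem one_sub_shrink_lt {β : ℝ} (hβ : 0 < β) (m : ℕ) : 1 - shrink β m < β := by
  have := one_sub_lt_shrink hβ m; linarith

/-- Positivity of the factor for `0 ≤ β < 1`. [cite: Balaban1988Convergent, (2.34) p.261] -/
theorem shrink_pos {β : ℝ} (hβ0 : 0 ≤ β) (hβ1 : β < 1) (m : ℕ) : 0 < shrink β m := by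
  have := one_sub_le_shrink hβ0 m; linarith

/-- With the printed choice `β ≤ 1/4`: `3/4 < shrink β m` — the same inequality as [IV] (1.96)
(`…B15.BasicStep.coeff196` with `t = 2^{−m}`). [cite: Balaban1988Convergent, p.261] -/
theorem three_quarters_lt_shrink {β : ℝ} (hβ : β ≤ 1 / 4) (m : ℕ) : 3 / 4 < shrink β m := by
  unfold shrink
  have h0 : 0 < (1 / 2 : ℝ) ^ m := by positivity
  have h1 : (1 / 2 : ℝ) ^ m ≤ 1 := pow_le_one₀ (by norm_num) (by norm_num)
  nlinarith

/-- The factor is antitone in the index gap `m = j − n` (`β ≥ 0`): older layers have smaller factors.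
[cite: Balaban1988Convergent, (2.34) p.261] -/
theorem shrink_antitone {β : ℝ} (hβ : 0 ≤ β) : Antitone (shrink β) := by
  intro m m' h
  unfold shrink
  have : (1 / 2 : ℝ) ^ m' ≤ (1 / 2 : ℝ) ^ m := pow_le_pow_of_le_one (by norm_num) (by norm_num) h
  nlinarith

/-- Strict decrease per index step for `β > 0`. [cite: Balaban1988Convergent, p.277] -/
theorem shrink_succ_lt {β : ℝ} (hβ : 0 < β) (m : ℕ) : shrink β (m + 1) < shrink β m := by
  have h := shrink_sub_succ β m
  have h0 : 0 < β * (1 / 2 : ℝ) ^ (m + 1) := by positivity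
  linarith

/-- Telescoping: the losses of the first `m` index steps sum to `1 − shrink β m = β(1 − 2^{−m})`.
[cite: Balaban1988Convergent, p.277] -/
theorem sum_losses (β : ℝ) (m : ℕ) :
    ∑ i ∈ range m, (shrink β i - shrink β (i + 1)) = 1 - shrink β m := by
  rw [Finset.sum_range_sub']; simp

/-- The total loss over ALL steps is exactly `β` (times the layer coefficient): a convergent geometric series in the
powers of 1/2 — claim (a) of cell GAPS.md G-B14s-15 / SMALLNESS.md S-B14.23 ("Σ_j (radius loss at step j) < the
radii"), as arithmetic. [cite: Balaban1988Convergent, p.277] -/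
theorem hasSum_losses (β : ℝ) : HasSum (fun m => shrink β m - shrink β (m + 1)) β := by
  have h := (hasSum_geometric_of_lt_one (by norm_num : (0 : ℝ) ≤ 1 / 2) (by norm_num : (1 / 2 : ℝ) < 1)).mul_left
    (β / 2)
  rw [show β / 2 * (1 - 1 / 2 : ℝ)⁻¹ = β by norm_num] at h
  have e : (fun m => shrink β m - shrink β (m + 1)) = fun m => β / 2 * (1 / 2 : ℝ) ^ m := by
    funext m
    rw [shrink_sub_succ]; ring
  rw [e]; exact h

/-! ## C. Absorption of a shift into the difference of two radii (the shape of claim (b), p. 277) -/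

/-- In any seminormed additive group: a point within `r′` of the centre, moved by at most `s`, stays within `r` of
the centre as soon as `r′ + s ≤ r`.  This is all that *"we have to use a part of the analyticity domains of terms in
𝐁_k for the function H_k"* asks of the radii. [folklore] -/
theorem absorb {E : Type*} [SeminormedAddCommGroup E] {u u' c : E} {r r' s : ℝ}
    (hu' : ‖u' - c‖ < r') (hs : ‖u - u'‖ ≤ s) (h : r' + s ≤ r) : ‖u - c‖ < r := by
  have htri : ‖u - c‖ ≤ ‖u - u'‖ + ‖u' - c‖ := by
    have e : u - c = (u - u') + (u' - c) := by abel
    rw [e]; exact norm_add_le _ _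
  linarith

/-- One index step of (2.34)-type radii with an overall coefficient `A` (`A = 1` for the hypothesis spaces of
p. 261, `A = 1 + β` for the spaces (3.43) of the newly created terms, p. 276) and layer coefficient `ρ`: a shift of
size at most the room `A·β·2^{−(m+1)}·ρ` moves the ball of radius `A·shrink β (m+1)·ρ` into the ball of radius
`A·shrink β m·ρ`. [cite: Balaban1988Convergent, p.277] -/
theorem absorb_step {E : Type*} [SeminormedAddCommGroup E] {u u' c : E} {A β ρ s : ℝ} {m : ℕ}
    (hu' : ‖u' - c‖ < A * shrink β (m + 1) * ρ) (hs : ‖u - u'‖ ≤ s)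
    (hroom : s ≤ A * (β * (1 / 2 : ℝ) ^ (m + 1)) * ρ) : ‖u - c‖ < A * shrink β m * ρ := by
  apply absorb hu' hs
  have e : A * shrink β m * ρ = A * shrink β (m + 1) * ρ + A * (β * (1 / 2 : ℝ) ^ (m + 1)) * ρ := by
    rw [← shrink_sub_succ]; ring
  linarith

/-- Conversely the room is sharp on the real line: if the shift budget `s ≥ 0` exceeds `r − r′` (`0 < r′`), some
admissible pair leaves the larger ball. [folklore] -/
theorem absorb_sharp {r r' s : ℝ} (hr' : 0 < r') (hs0 : 0 ≤ s) (h : r < r' + s) :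
    ∃ u u' : ℝ, |u' - 0| < r' ∧ |u - u'| ≤ s ∧ ¬ |u - 0| < r := by
  have hs : r - r' < s := by linarith
  -- choose u' just inside the small ball and push outward by s' ≤ s
  obtain ⟨δ, hδ0, hδr', hδs⟩ : ∃ δ : ℝ, 0 < δ ∧ δ < r' ∧ r - r' + δ ≤ s := by
    refine ⟨min (r' / 2) ((s - (r - r')) / 2), ?_, ?_, ?_⟩
    · apply lt_min <;> linarith
    · have := min_le_left (r' / 2) ((s - (r - r')) / 2); linarith
    · have := min_le_right (r' / 2) ((s - (r - r')) / 2); linarith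
  refine ⟨(r' - δ) + max (r - r' + δ) 0, r' - δ, ?_, ?_, ?_⟩
  · rw [sub_zero, abs_lt]; constructor <;> linarith
  · have e : (r' - δ) + max (r - r' + δ) 0 - (r' - δ) = max (r - r' + δ) 0 := by ring
    rw [e, abs_of_nonneg (le_max_right _ _)]
    exact max_le hδs hs0
  · rw [sub_zero, not_lt]
    have h1 : r - r' + δ ≤ max (r - r' + δ) 0 := le_max_left _ _
    have h2 : (0 : ℝ) ≤ max (r - r' + δ) 0 := le_max_right _ _
    rw [abs_of_nonneg (by linarith)]
    linarith

/-! ## D. The one-step room per layer (reading R1 of p. 277; cell DIVERGENCE.md D-pv02.15) -/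

/-- The room at layer `n ≤ k` when the space index advances `k → k+1`, in the units of `rad234_eq` (plaquette
deviations measured on the unit lattice), with overall coefficient `A`:
`A·(shrink β (k−n) − shrink β (k+1−n))·α_{0,n}·L^{−2n}`. [cite: Balaban1988Convergent, p.277] -/
def room (A β α₀n L : ℝ) (k n : ℕ) : ℝ := A * (shrink β (k - n) - shrink β (k + 1 - n)) * α₀n / (L ^ n) ^ 2

/-- `room = A·β·2^{−(k+1−n)}·α_{0,n}·L^{−2n}` for `n ≤ k`. [cite: Balaban1988Convergent, p.277] -/
theorem room_eq {A β α₀n L : ℝ} {k n : ℕ} (hn : n ≤ k) :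
    room A β α₀n L k n = A * (β * (1 / 2 : ℝ) ^ (k - n + 1)) * α₀n / (L ^ n) ^ 2 := by
  unfold room
  rw [show k + 1 - n = k - n + 1 by omega, shrink_sub_succ]

/-- The innermost layer `n = k` (the collar `Ω_k∖Ω_{k+1}` seen from step `k+1`; factor `1 ↦ 1 − β/2`): room
`A·(β/2)·α_{0,k}·L^{−2k}` — the LARGEST relative loss, and the layer where p. 277 grants *"no regularity
improvement"* and no decay of `H_k`. [cite: Balaban1988Convergent, p.277] -/
theorem room_innermost (A β α₀k L : ℝ) (k : ℕ) :
    room A β α₀k L k k = A * (β / 2) * α₀k / (L ^ k) ^ 2 := by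
  unfold room
  simp only [Nat.sub_self, Nat.add_sub_cancel_left, shrink_zero, shrink_one]
  ring

/-- Innermost comparison: a shift of plaquette size `c·ε_k·L^{−2k}` (`η = L^{−k}`; e.g. the `H_k`-part of (3.8)
p. 266, `(2/10)ε_kη²(1 + (4/10)ε_k) + (2/10)ε_kη·|U_{k+1}(∂p) − 1|`, typed in `…B14Sect3.Ineq38Printed`) fits into
the innermost room iff `c·ε_k ≤ A·(β/2)·α_{0,k}`. [cite: Balaban1988Convergent, p.277] -/
theorem innermost_fits_iff {A β α₀k L c εk : ℝ} (hL : 0 < L) (k : ℕ) :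
    c * εk / (L ^ k) ^ 2 ≤ room A β α₀k L k k ↔ c * εk ≤ A * (β / 2) * α₀k := by
  rw [room_innermost, div_le_div_iff_of_pos_right (by positivity)]

/-- Older layers are not binding, for scale reasons alone: if `α_{0,k} ≤ (L²/2)^{k−n}·α_{0,n}` (a comparability of
the coefficients across scales which (2.6)–(2.7), p. 255, make polynomial in `k − n` — NOT discharged here), then the
room at layer `n ≤ k` is at least the innermost room (`A, β ≥ 0`, `L > 0`), because the coarser plaquette scale
contributes `L^{2(k−n)}` against the `2^{−(k−n)}` of the half-powers.  p. 277 invokes, in addition, the exponential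
decay of `H_k` across the layers. [cite: Balaban1988Convergent, p.277] -/
theorem room_mono_layer {A β α₀k α₀n L : ℝ} {k n : ℕ} (hA : 0 ≤ A) (hβ : 0 ≤ β) (hL : 0 < L) (hn : n ≤ k)
    (hα : α₀k ≤ (L ^ 2 / 2) ^ (k - n) * α₀n) : room A β α₀k L k k ≤ room A β α₀n L k n := by
  obtain ⟨d, rfl⟩ := Nat.exists_eq_add_of_le hn
  have hd : n + d - n = d := Nat.add_sub_cancel_left n d
  rw [hd] at hα
  rw [room_innermost, room_eq hn, hd, div_le_div_iff₀ (by positivity) (by positivity)]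
  have hPQ : (L ^ 2 / 2) ^ d = (L ^ 2) ^ d * (1 / 2 : ℝ) ^ d := by
    rw [div_eq_mul_one_div, mul_pow]
  have hX : 0 ≤ A * (β / 2) * (L ^ n) ^ 2 := by positivity
  have key := mul_le_mul_of_nonneg_left hα hX
  calc A * (β / 2) * α₀k * (L ^ n) ^ 2 = A * (β / 2) * (L ^ n) ^ 2 * α₀k := by ring
    _ ≤ A * (β / 2) * (L ^ n) ^ 2 * ((L ^ 2 / 2) ^ d * α₀n) := key
    _ = A * (β * (1 / 2 : ℝ) ^ (d + 1)) * α₀n * (L ^ (n + d)) ^ 2 := by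
        rw [hPQ]; ring

/-! ## E. The binding comparison `c·ε_j ≤ κ·α_{0,j}` against the printed exponents (2.4), (2.28) -/

/-- Containment at every layer from containment with the floor factor: if `c·ε ≤ (1 − β)·α` (`β ≥ 0`, `α ≥ 0`) then
`c·ε ≤ shrink β m · α` for every index gap `m` — the multi-scale form of [I] p. 263 *"for α₀′ sufficiently small the
above estimates imply the condition (iv)"* (there `c = 2B₃`, cell SMALLNESS.md S-B12.5). [cite: Balaban1987RG1, (1.17) p.263] -/
theorem fits_all_layers {c ε β α : ℝ} (hβ : 0 ≤ β) (hα : 0 ≤ α) (h : c * ε ≤ (1 - β) * α) (m : ℕ) :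
    c * ε ≤ shrink β m * α := by
  have := mul_le_mul_of_nonneg_right (one_sub_le_shrink hβ m) hα
  linarith

/-- … and at the innermost region (`m = 0`, factor `1`) containment is exactly `c·ε ≤ α`: no factor helps there.
[cite: Balaban1988Convergent, (2.34) p.261] -/
theorem fits_innermost_iff (c ε β α : ℝ) : c * ε ≤ shrink β 0 * α ↔ c * ε ≤ α := by simp

/-- SUFFICIENCY of the reconstructed exponent restriction (cell SMALLNESS.md §4.1 (X12)): with the printed
`ε_j = g_jA₀x^{p₀}` (2.4) and `α_{0,j} = g_jC₀x^{q₀}` (2.28), `x = log g_j^{−2} ≥ 1`, the comparison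
`c·ε_j ≤ κ·α_{0,j}` holds for ALL `x ≥ 1`, `g ≥ 0` as soon as `p₀ ≤ q₀` and `c·A₀ ≤ κ·C₀` (*"C₀ … sufficiently
large"*). [cite: Balaban1988Convergent, (2.28) p.259] -/
theorem fits_of_exponents {c κ A₀ C₀ g x : ℝ} {p₀ q₀ : ℕ} (hc : 0 ≤ c) (hA : 0 ≤ A₀) (hg : 0 ≤ g)
    (hx : 1 ≤ x) (hpq : p₀ ≤ q₀) (hC : c * A₀ ≤ κ * C₀) :
    c * (g * A₀ * x ^ p₀) ≤ κ * (g * C₀ * x ^ q₀) := by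
  have hx0 : 0 ≤ x := le_trans zero_le_one hx
  have hxp : x ^ p₀ ≤ x ^ q₀ := pow_le_pow_right₀ hx hpq
  have h1 : c * (g * A₀ * x ^ p₀) = (c * A₀) * (g * x ^ p₀) := by ring
  have h2 : κ * (g * C₀ * x ^ q₀) = (κ * C₀) * (g * x ^ q₀) := by ring
  rw [h1, h2]
  apply mul_le_mul hC (mul_le_mul_of_nonneg_left hxp hg) (mul_nonneg hg (pow_nonneg hx0 _))
  exact le_trans (mul_nonneg hc hA) hC

/-- NECESSITY (cell SMALLNESS.md §4.1 (X12)): if the comparison `c·ε_j ≤ κ·α_{0,j}` (`c, κ, A₀, C₀ > 0`) is to hold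
at arbitrarily small couplings — for every `x ≥ X` at least one `g > 0` satisfies it (the factor `g_j` cancels) —
then `p₀ ≤ q₀`.  (2.28) prints only *"q₀, q₁ are integers greater than 1"*; the restriction `q₀ ≥ p₀` is the cell's
reconstruction, not the paper's statement. [cite: Balaban1988Convergent, (2.28) p.259] -/
theorem exponent_necessary {c κ A₀ C₀ : ℝ} {p₀ q₀ : ℕ} (hc : 0 < c) (hκ : 0 < κ) (hA : 0 < A₀) (hC : 0 < C₀)
    (X : ℝ) (h : ∀ x : ℝ, X ≤ x → ∃ g : ℝ, 0 < g ∧ c * (g * A₀ * x ^ p₀) ≤ κ * (g * C₀ * x ^ q₀)) :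
    p₀ ≤ q₀ := by
  rcases Nat.lt_or_ge q₀ p₀ with hlt | hge
  swap
  · exact hge
  exfalso
  set x : ℝ := max X (max 1 (κ * C₀ / (c * A₀) + 1)) with hxdef
  obtain ⟨g, hg, hle⟩ := h x (le_max_left _ _)
  have hx1 : 1 ≤ x := le_trans (le_max_left _ _) (le_max_right _ _)
  have hxK : κ * C₀ / (c * A₀) + 1 ≤ x := le_trans (le_max_right _ _) (le_max_right _ _)
  have hcA : 0 < c * A₀ := mul_pos hc hA
  have hxq : 0 < x ^ q₀ := pow_pos (by linarith) _
  have hxpow : x ^ q₀ * x ≤ x ^ p₀ := by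
    calc x ^ q₀ * x = x ^ (q₀ + 1) := by ring
      _ ≤ x ^ p₀ := pow_le_pow_right₀ hx1 (by omega)
  have e1 : c * (g * A₀ * x ^ p₀) = g * (c * A₀ * x ^ p₀) := by ring
  have e2 : κ * (g * C₀ * x ^ q₀) = g * (κ * C₀ * x ^ q₀) := by ring
  rw [e1, e2] at hle
  have hle' : c * A₀ * x ^ p₀ ≤ κ * C₀ * x ^ q₀ := le_of_mul_le_mul_left hle hg
  have h3 : c * A₀ * (κ * C₀ / (c * A₀) + 1) ≤ c * A₀ * x := mul_le_mul_of_nonneg_left hxK hcA.le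
  have e3 : c * A₀ * (κ * C₀ / (c * A₀) + 1) = κ * C₀ + c * A₀ := by
    field_simp
  rw [e3] at h3
  have h3' : κ * C₀ < c * A₀ * x := by linarith
  have h4 : κ * C₀ * x ^ q₀ < c * A₀ * x * x ^ q₀ := mul_lt_mul_of_pos_right h3' hxq
  have h5 : c * A₀ * x * x ^ q₀ ≤ c * A₀ * x ^ p₀ := by
    have := mul_le_mul_of_nonneg_left hxpow hcA.le
    calc c * A₀ * x * x ^ q₀ = c * A₀ * (x ^ q₀ * x) := by ring
      _ ≤ c * A₀ * x ^ p₀ := this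
  linarith

/-- The cell's previous minimal exponent witness (SMALLNESS.md §4.3: `p₀ = 23`, `q₀ = 2`) is incompatible with
the comparison at small couplings, whatever the positive absolute constants — so the witness is re-chosen with
`q₀ ≥ p₀` (the printed (X1)–(X11) constrain `q₀` only by `q₀ ≥ 2`). -/
example {c κ A₀ C₀ : ℝ} (hc : 0 < c) (hκ : 0 < κ) (hA : 0 < A₀) (hC : 0 < C₀) (X : ℝ) :
    ¬ ∀ x : ℝ, X ≤ x → ∃ g : ℝ, 0 < g ∧ c * (g * A₀ * x ^ 23) ≤ κ * (g * C₀ * x ^ 2) :=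
  fun h => absurd (exponent_necessary hc hκ hA hC X h) (by norm_num)

/-- The two ends assembled at the innermost layer (reading R1): with `p₀ ≤ q₀`, `c·A₀ ≤ A(β/2)·C₀`, a shift of
plaquette size `c·ε_k·L^{−2k}`, `ε_k = g_kA₀x^{p₀}`, fits into the innermost one-step room of the `α_{0,k} = g_kC₀x^{q₀}`
radii for every `x ≥ 1`, `g_k ≥ 0`, `L > 0`. [cite: Balaban1988Convergent, p.277] -/
theorem innermost_fits_of_exponents {A β c A₀ C₀ g x L : ℝ} {p₀ q₀ : ℕ} {k : ℕ} (hc : 0 ≤ c) (hA₀ : 0 ≤ A₀)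
    (hg : 0 ≤ g) (hx : 1 ≤ x) (hL : 0 < L) (hpq : p₀ ≤ q₀) (hC : c * A₀ ≤ A * (β / 2) * C₀) :
    c * (g * A₀ * x ^ p₀) / (L ^ k) ^ 2 ≤ room A β (g * C₀ * x ^ q₀) L k k := by
  rw [innermost_fits_iff hL]
  have := fits_of_exponents (κ := A * (β / 2)) hc hA₀ hg hx hpq hC
  linarith

end Literature.MathematicalPhysics.QuantumFieldTheory.Balaban1983to89.B14Radii

end
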